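import Mathlib
import HarnessLib
import Summits.HubbardSuperconductivity.HubbardSuperconductivity.Theorems.KLProgrammeThinLevelSetHarmonicRow

/-!
# Route `KLProgramme` — K3 engine (stmt-HubbardSuperconductivity-20437), stub (b) (ℓ)/(I2)–(I3), located item «ABS-UMK-COUNT» / «ABS-UMK-34»:
# the anchored triple count for a MIXED-SIGN triple (indefinite normal constraint) — one logarithm, curvature floor only

Cell gate-hubbard-kl, seat p4 g16 (generic brick; twin of `card_tripleWindow_le`, p616378).  In the narrow-bundle count of target strings the kept triple of free
legs has so far EQUAL signs (`f(a) + f(b) + f(c)`, a DEFINITE window, `card_tripleWindow_le` via the volume of a strongly convex level window — which is why the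
coverage lemma needs five free legs).  For a triple with a MIXED sign pattern `(+, +, −)` (the third leg on the antipodal branch) the tangential constraint reads
`a + b − g = τ ± δ_t` and the normal one `f(a) + f(b) − f(g) = β ± δ_n`; eliminating the third leg leaves the INDEFINITE window
`|f(a) + f(b) − f(a + b − τ) − β| ≤ δ′`, whose only critical point is the non-degenerate saddle `(τ, τ)`: on the row `b` the function is monotone in `a`
with slope `≥ c·|b − τ|` (`f′(a) − f′(a + (b−τ))` against the curvature FLOOR `c ≤ f″`, no ceiling needed), so the row holds `≤ 2δ′/(c·h·|b−τ|) + 1`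
points of an `h`-separated set and the harmonic sum over the rows costs ONE logarithm:

(one-dimensional bricks `sum_inv_sub_le_of_separated`, `card_row_le_of_slope`: file `…ThinLevelSetHarmonicRow`)
* **`card_tripleWindowIndef_le`** — `#{(a,b,g) ∈ G×G×G′ : |a+b−g−τ| ≤ δ_t, |f a + f b − f g − β| ≤ δ_n} ≤ (2δ_t/h + 1)·(4(2ρ₀/h + 1) + (4(δ_n + Bδ_t)/(c h²))·(1 + log((4ρ₀+δ_t)/h + 1)))`
  for `h`-separated `G, G′ ⊂ [−ρ₀, ρ₀]` (the third, opposite-sign leg may run over its own grid `G′`), `c ≤ f″`, `|f′| ≤ B` on `[−Λ, Λ]`, `Λ ≥ 5ρ₀ + δ_t`.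

Everything is PROVED; no definitions, no named facts; elementary real analysis. [folklore]
-/

noncomputable section

open Real Set Metric

namespace Summit.HubbardSuperconductivity.HubbardSuperconductivity.Theorems.ThinLevelSet

set_option linter.dupNamespace false -- summit = problem name (single-conjunct summit), D-0017

/-! ## The anchored triple count, mixed signs -/

set_option maxHeartbeats 400000 in -- many elementary dischargers in one proof (as `card_tripleWindow_le`)
/-- **The anchored triple count for a mixed-sign triple** (see the module docstring): for `h`-separated finite `G, G′ ⊂ [−ρ₀, ρ₀]`, a chart `f` with
`c ≤ f″` and `|f′| ≤ B` on `[−Λ, Λ]`, `Λ ≥ 5ρ₀ + δ_t`, and every `τ, β`,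
`#{(a,b,g) ∈ G×G×G′ : |a + b − g − τ| ≤ δ_t ∧ |f a + f b − f g − β| ≤ δ_n} ≤ (2δ_t/h + 1)·(4(2ρ₀/h + 1) + (4(δ_n + Bδ_t)/(c·h²))·(1 + log((4ρ₀ + δ_t)/h + 1)))`.
[folklore] -/
theorem card_tripleWindowIndef_le {f f' f'' : ℝ → ℝ} {ρ₀ Λ c B h δt δn : ℝ}
    (hρ₀ : 0 ≤ ρ₀) (hh : 0 < h) (hc : 0 < c) (hB : 0 ≤ B) (hδt : 0 ≤ δt) (hδn : 0 ≤ δn) (hΛ : 5 * ρ₀ + δt ≤ Λ)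
    (hf : ∀ u ∈ Icc (-Λ) Λ, HasDerivAt f (f' u) u) (hf' : ∀ u ∈ Icc (-Λ) Λ, HasDerivAt f' (f'' u) u)
    (hfloor : ∀ u ∈ Icc (-Λ) Λ, c ≤ f'' u) (hder : ∀ u ∈ Icc (-Λ) Λ, |f' u| ≤ B)
    (G : Finset ℝ) (hG : ∀ g ∈ G, |g| ≤ ρ₀) (hsep : ∀ g ∈ G, ∀ g' ∈ G, g ≠ g' → h ≤ |g - g'|)
    (G' : Finset ℝ) (hG' : ∀ g ∈ G', |g| ≤ ρ₀) (hsep' : ∀ g ∈ G', ∀ g' ∈ G', g ≠ g' → h ≤ |g - g'|) (τ β : ℝ) :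
    ((((G ×ˢ G) ×ˢ G').filter fun t : (ℝ × ℝ) × ℝ =>
        |t.1.1 + t.1.2 - t.2 - τ| ≤ δt ∧ |f t.1.1 + f t.1.2 - f t.2 - β| ≤ δn).card : ℝ) ≤
      (2 * δt / h + 1) * (4 * (2 * ρ₀ / h + 1) + 4 * (δn + B * δt) / (c * h ^ 2) * (1 + Real.log ((4 * ρ₀ + δt) / h + 1))) := by
  classical
  set T := ((G ×ˢ G) ×ˢ G').filter fun t : (ℝ × ℝ) × ℝ =>
      |t.1.1 + t.1.2 - t.2 - τ| ≤ δt ∧ |f t.1.1 + f t.1.2 - f t.2 - β| ≤ δn with hT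
  set δ' := δn + B * δt with hδ'
  have hδ'0 : 0 ≤ δ' := by rw [hδ']; positivity
  set Lg : ℝ := 1 + Real.log ((4 * ρ₀ + δt) / h + 1) with hLg
  have hLg0 : 0 ≤ Lg := by
    rw [hLg]
    have : 0 ≤ Real.log ((4 * ρ₀ + δt) / h + 1) := Real.log_nonneg (by linarith [div_nonneg (by positivity : 0 ≤ 4 * ρ₀ + δt) hh.le])
    linarith
  have hRHS : 0 ≤ (2 * δt / h + 1) * (4 * (2 * ρ₀ / h + 1) + 4 * (δn + B * δt) / (c * h ^ 2) * Lg) := by positivity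
  -- `f` is `B`-Lipschitz on `[−Λ, Λ]`, `f′` grows at rate `≥ c`
  have hLip := abs_sub_le_mul_abs_sub_of_hasDerivAt_le hf hder
  have hgrow := mul_sub_le_sub_of_hasDerivAt_ge hf' hfloor
  have hGabs : ∀ g ∈ G, -ρ₀ ≤ g ∧ g ≤ ρ₀ := fun g hg => abs_le.1 (hG g hg)
  have hGabs' : ∀ g ∈ G', -ρ₀ ≤ g ∧ g ≤ ρ₀ := fun g hg => abs_le.1 (hG' g hg)
  -- the size of `G`
  have hGcard : (G.card : ℝ) ≤ 2 * ρ₀ / h + 1 := by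
    have h1 := card_le_of_separated_subset_Icc hh (a := -ρ₀) (b := ρ₀) (by linarith) G (fun g hg => by
      obtain ⟨h1, h2⟩ := hGabs g hg; exact ⟨h1, h2⟩) hsep
    have e : (ρ₀ - -ρ₀) / h + 1 = 2 * ρ₀ / h + 1 := by ring
    rwa [e] at h1
  by_cases hτ : |τ| ≤ 3 * ρ₀ + δt
  swap
  · -- degenerate case: no triple at all
    have hTe : T = ∅ := by
      rw [Finset.eq_empty_iff_forall_notMem]
      rintro ⟨⟨a, b⟩, g⟩ ht
      rw [hT, Finset.mem_filter, Finset.mem_product, Finset.mem_product] at ht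
      obtain ⟨⟨⟨ha, hb⟩, hg⟩, h1, -⟩ := ht
      simp only at ha hb hg h1
      obtain ⟨ha1, ha2⟩ := hGabs a ha
      obtain ⟨hb1, hb2⟩ := hGabs b hb
      obtain ⟨hg1, hg2⟩ := hGabs' g hg
      have h1' := abs_le.1 h1
      exact hτ (abs_le.2 ⟨by linarith, by linarith⟩)
    rw [hTe, Finset.card_empty, Nat.cast_zero]
    exact hRHS
  -- main case: `|τ| ≤ 3ρ₀ + δ_t`
  have hτ' := abs_le.1 hτ
  set W := (G ×ˢ G).filter fun p : ℝ × ℝ => |f p.1 + f p.2 - f (p.1 + p.2 - τ) - β| ≤ δ' with hW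
  set C : ℝ × ℝ → Finset ℝ := fun p => G'.filter fun g => |p.1 + p.2 - g - τ| ≤ δt with hC
  -- every triple projects to a pair of `W` with third coordinate in `C`
  have hsub : T ⊆ W.biUnion fun p => (C p).image fun g => (p, g) := by
    rintro ⟨⟨a, b⟩, g⟩ ht
    rw [hT, Finset.mem_filter, Finset.mem_product, Finset.mem_product] at ht
    obtain ⟨⟨⟨ha, hb⟩, hg⟩, h1, h2⟩ := ht
    simp only at ha hb hg h1 h2
    rw [Finset.mem_biUnion]
    refine ⟨(a, b), ?_, ?_⟩
    · rw [hW, Finset.mem_filter, Finset.mem_product]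
      refine ⟨⟨ha, hb⟩, ?_⟩
      simp only
      obtain ⟨hg1, hg2⟩ := hGabs' g hg
      obtain ⟨ha1, ha2⟩ := hGabs a ha
      obtain ⟨hb1, hb2⟩ := hGabs b hb
      have h1' := abs_le.1 h1
      have hgI : g ∈ Icc (-Λ) Λ := ⟨by linarith, by linarith⟩
      have hτI : a + b - τ ∈ Icc (-Λ) Λ := ⟨by linarith, by linarith⟩
      have hL := hLip g hgI (a + b - τ) hτI
      have hd : |a + b - τ - g| ≤ δt := by
        rw [abs_le]; constructor <;> linarith
      have hL' : |f (a + b - τ) - f g| ≤ B * δt := hL.trans (mul_le_mul_of_nonneg_left hd hB)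
      have hsplit : f a + f b - f (a + b - τ) - β = (f a + f b - f g - β) - (f (a + b - τ) - f g) := by ring
      rw [hsplit, hδ']
      exact (abs_sub _ _).trans (add_le_add h2 hL')
    · rw [Finset.mem_image]
      refine ⟨g, ?_, rfl⟩
      rw [hC, Finset.mem_filter]
      exact ⟨hg, h1⟩
  -- the third coordinate: at most `2δ_t/h + 1` choices
  have hCcard : ∀ p : ℝ × ℝ, (((C p).image fun g => (p, g)).card : ℝ) ≤ 2 * δt / h + 1 := by
    intro p
    have hinj : Function.Injective fun g : ℝ => (p, g) := fun x y hxy => (Prod.ext_iff.1 hxy).2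
    rw [Finset.card_image_of_injective _ hinj]
    have h1 := card_le_of_separated_subset_Icc hh (a := p.1 + p.2 - τ - δt) (b := p.1 + p.2 - τ + δt) (by linarith) (C p)
      (fun g hg => by
        rw [hC, Finset.mem_filter] at hg
        have := abs_le.1 hg.2
        exact ⟨by linarith, by linarith⟩)
      (fun x hx y hy hxy => by
        rw [hC, Finset.mem_filter] at hx hy
        exact hsep' x hx.1 y hy.1 hxy)
    have h2 : (p.1 + p.2 - τ + δt - (p.1 + p.2 - τ - δt)) / h + 1 = 2 * δt / h + 1 := by ring
    rwa [h2] at h1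
  -- the rows of `W`
  set Row : ℝ → Finset ℝ := fun b => G.filter fun a => |f a + f b - f (a + b - τ) - β| ≤ δ' with hRow
  have hWrows : (W.card : ℝ) = ∑ b ∈ G, ((Row b).card : ℝ) := by
    have hfib := Finset.card_eq_sum_card_fiberwise (f := fun p : ℝ × ℝ => p.2) (s := W) (t := G)
      (fun p hp => by
        have hp' : p ∈ W := by exact_mod_cast hp
        rw [hW, Finset.mem_filter, Finset.mem_product] at hp'
        exact_mod_cast hp'.1.2)
    rw [hfib]
    push_cast
    refine Finset.sum_congr rfl fun b hb => ?_
    have hfeq : W.filter (fun p : ℝ × ℝ => p.2 = b) = (Row b).image fun a => (a, b) := by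
      ext ⟨a, b'⟩
      simp only [hW, hRow, Finset.mem_filter, Finset.mem_product, Finset.mem_image, Prod.mk.injEq]
      constructor
      · rintro ⟨⟨⟨ha, -⟩, hwin⟩, rfl⟩
        exact ⟨a, ⟨ha, hwin⟩, rfl, rfl⟩
      · rintro ⟨a', ⟨ha', hwin⟩, rfl, rfl⟩
        exact ⟨⟨⟨ha', hb⟩, hwin⟩, rfl⟩
    have hinj : Function.Injective fun a : ℝ => (a, b) := fun x y hxy => (Prod.ext_iff.1 hxy).1
    rw [hfeq, Finset.card_image_of_injective _ hinj]
  -- a FAR row (`|b − τ| ≥ h`): slope `≥ c|b − τ|` in `a`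
  have hfar : ∀ b ∈ G, h ≤ |b - τ| → ((Row b).card : ℝ) ≤ 2 * δ' / (c * |b - τ| * h) + 1 := by
    intro b hb hbτ
    obtain ⟨hb1, hb2⟩ := hGabs b hb
    set s := b - τ with hs
    have hs0 : 0 < |s| := hh.trans_le hbτ
    refine card_row_le_of_slope (φ := fun a => f a + f b - f (a + b - τ)) (by positivity : 0 < c * |b - τ|) hh hδ'0 (Row b)
      ?_ (fun a ha => by rw [hRow, Finset.mem_filter] at ha; simpa using ha.2)
      (fun x hx y hy hxy => by rw [hRow, Finset.mem_filter] at hx hy; exact hsep x hx.1 y hy.1 hxy)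
    intro x hx y hy hxy
    rw [hRow, Finset.mem_filter] at hx hy
    obtain ⟨hx1, hx2⟩ := hGabs x hx.1
    obtain ⟨hy1, hy2⟩ := hGabs y hy.1
    -- `f′(u + s) − f′(u)` has the sign of `s` and size `≥ c|s|`; integrate along `[x, y]`
    have hxI : x ∈ Icc (-Λ) Λ := ⟨by linarith, by linarith⟩
    have hyI : y ∈ Icc (-Λ) Λ := ⟨by linarith, by linarith⟩
    have hxsI : x + s ∈ Icc (-Λ) Λ := ⟨by rw [hs]; linarith, by rw [hs]; linarith⟩
    have hysI : y + s ∈ Icc (-Λ) Λ := ⟨by rw [hs]; linarith, by rw [hs]; linarith⟩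
    -- the shifted difference `φ u = f(u + s) − f u` on `[x, y]`
    have hφ : ∀ u ∈ Icc x y, HasDerivAt (fun u => f (u + s) - f u) (f' (u + s) - f' u) u := by
      intro u hu
      have huI : u ∈ Icc (-Λ) Λ := ⟨by linarith [hu.1], by linarith [hu.2]⟩
      have husI : u + s ∈ Icc (-Λ) Λ := ⟨by rw [hs]; linarith [hu.1], by rw [hs]; linarith [hu.2]⟩
      exact ((hf (u + s) husI).comp_add_const u s).sub (hf u huI)
    have e : (f y + f b - f (y + b - τ)) - (f x + f b - f (x + b - τ)) = -((f (y + s) - f y) - (f (x + s) - f x)) := by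
      rw [hs]; ring
    rw [e, abs_neg]
    rcases le_or_gt 0 s with hs1 | hs1
    · -- `s ≥ h > 0`: `φ′ ≥ c·s`
      have hsabs : |s| = s := abs_of_nonneg hs1
      have hder' : ∀ u ∈ Icc x y, c * |b - τ| ≤ f' (u + s) - f' u := by
        intro u hu
        have huI : u ∈ Icc (-Λ) Λ := ⟨by linarith [hu.1], by linarith [hu.2]⟩
        have husI : u + s ∈ Icc (-Λ) Λ := ⟨by rw [hs]; linarith [hu.1], by rw [hs]; linarith [hu.2]⟩
        have := hgrow u huI (u + s) husI (by linarith)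
        rw [← hs, hsabs]
        linarith
      have h1 := mul_sub_le_sub_of_hasDerivAt_ge hφ hder' x ⟨le_rfl, hxy⟩ y ⟨hxy, le_rfl⟩ hxy
      exact h1.trans (le_abs_self _)
    · -- `s ≤ −h < 0`: `−φ′ ≥ c·|s|`
      have hsabs : |s| = -s := abs_of_neg hs1
      have hφn : ∀ u ∈ Icc x y, HasDerivAt (fun u => -(f (u + s) - f u)) (-(f' (u + s) - f' u)) u :=
        fun u hu => (hφ u hu).neg
      have hder' : ∀ u ∈ Icc x y, c * |b - τ| ≤ -(f' (u + s) - f' u) := by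
        intro u hu
        have huI : u ∈ Icc (-Λ) Λ := ⟨by linarith [hu.1], by linarith [hu.2]⟩
        have husI : u + s ∈ Icc (-Λ) Λ := ⟨by rw [hs]; linarith [hu.1], by rw [hs]; linarith [hu.2]⟩
        have := hgrow (u + s) husI u huI (by linarith)
        rw [← hs, hsabs]
        linarith
      have h1 := mul_sub_le_sub_of_hasDerivAt_ge hφn hder' x ⟨le_rfl, hxy⟩ y ⟨hxy, le_rfl⟩ hxy
      have e2 : -(f (y + s) - f y) - -(f (x + s) - f x) = -((f (y + s) - f y) - (f (x + s) - f x)) := by ring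
      rw [e2] at h1
      exact h1.trans (neg_le_abs _)
  -- NEAR rows (`|b − τ| < h`): at most three of them, each of size `≤ #G`
  set Gfar := G.filter fun b => h ≤ |b - τ| with hGfar
  set Gnear := G.filter fun b => ¬ h ≤ |b - τ| with hGnear
  have hnear_card : (Gnear.card : ℝ) ≤ 3 := by
    have h1 := card_le_of_separated_subset_Icc hh (a := τ - h) (b := τ + h) (by linarith) Gnear
      (fun b hb => by
        rw [hGnear, Finset.mem_filter] at hb
        have := abs_lt.1 (not_le.1 hb.2)
        exact ⟨by linarith, by linarith⟩)
      (fun x hx y hy hxy => by rw [hGnear, Finset.mem_filter] at hx hy; exact hsep x hx.1 y hy.1 hxy)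
    have e : (τ + h - (τ - h)) / h + 1 = 3 := by field_simp; ring
    rwa [e] at h1
  have hrow_triv : ∀ b, ((Row b).card : ℝ) ≤ 2 * ρ₀ / h + 1 := fun b =>
    le_trans (by exact_mod_cast Finset.card_le_card (Finset.filter_subset _ _)) hGcard
  -- the harmonic sums over the far rows, right and left of `τ`
  set Gri := Gfar.filter fun b => 0 ≤ b - τ with hGri
  set Gle := Gfar.filter fun b => ¬ 0 ≤ b - τ with hGle
  have hR4 : 0 ≤ 4 * ρ₀ + δt := by positivity
  have hsumR : ∑ b ∈ Gri, 1 / |b - τ| ≤ Lg / h := by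
    have h1 := sum_inv_sub_le_of_separated hh hR4 Gri (τ := τ)
      (fun b hb => by
        rw [hGri, Finset.mem_filter, hGfar, Finset.mem_filter] at hb
        obtain ⟨⟨hbG, hbf⟩, hb0⟩ := hb
        obtain ⟨hb1, hb2⟩ := hGabs b hbG
        rw [abs_of_nonneg hb0] at hbf
        exact ⟨hbf, by linarith⟩)
      (fun x hx y hy hxy => by
        rw [hGri, Finset.mem_filter, hGfar, Finset.mem_filter] at hx hy
        exact hsep x hx.1.1 y hy.1.1 hxy)
    rw [hLg]
    refine le_trans (le_of_eq (Finset.sum_congr rfl fun b hb => ?_)) h1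
    rw [hGri, Finset.mem_filter] at hb
    rw [abs_of_nonneg hb.2]
  have hsumL : ∑ b ∈ Gle, 1 / |b - τ| ≤ Lg / h := by
    -- reflect: `b ↦ −b`, `τ ↦ −τ`
    have h1 := sum_inv_sub_le_of_separated hh hR4 (Gle.image fun b => -b) (τ := -τ)
      (fun b' hb' => by
        rw [Finset.mem_image] at hb'
        obtain ⟨b, hb, rfl⟩ := hb'
        rw [hGle, Finset.mem_filter, hGfar, Finset.mem_filter] at hb
        obtain ⟨⟨hbG, hbf⟩, hb0⟩ := hb
        have hb0' : b - τ < 0 := lt_of_not_ge hb0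
        obtain ⟨hb1, hb2⟩ := hGabs b hbG
        rw [abs_of_neg hb0'] at hbf
        exact ⟨by linarith, by linarith⟩)
      (fun x hx y hy hxy => by
        rw [Finset.mem_image] at hx hy
        obtain ⟨x₀, hx₀, rfl⟩ := hx
        obtain ⟨y₀, hy₀, rfl⟩ := hy
        rw [hGle, Finset.mem_filter, hGfar, Finset.mem_filter] at hx₀ hy₀
        have hne : x₀ ≠ y₀ := fun e => hxy (by rw [e])
        have := hsep x₀ hx₀.1.1 y₀ hy₀.1.1 hne
        rwa [show (-x₀ : ℝ) - -y₀ = -(x₀ - y₀) by ring, abs_neg])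
    rw [Finset.sum_image (fun x _ y _ (hxy : -x = -y) => neg_injective hxy)] at h1
    rw [hLg]
    refine le_trans (le_of_eq (Finset.sum_congr rfl fun b hb => ?_)) h1
    rw [hGle, Finset.mem_filter] at hb
    rw [show (-b - -τ : ℝ) = -(b - τ) by ring, abs_of_neg (lt_of_not_ge hb.2)]
  have hsum_far : ∑ b ∈ Gfar, 1 / |b - τ| ≤ 2 * Lg / h := by
    rw [← Finset.sum_filter_add_sum_filter_not Gfar (fun b => 0 ≤ b - τ)]
    have hadd := add_le_add hsumR hsumL
    have e : Lg / h + Lg / h = 2 * Lg / h := by ring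
    exact hadd.trans e.le
  -- the far rows together
  have hfar_sum : ∑ b ∈ Gfar, ((Row b).card : ℝ) ≤ 2 * δ' / (c * h) * (2 * Lg / h) + (2 * ρ₀ / h + 1) := by
    calc ∑ b ∈ Gfar, ((Row b).card : ℝ) ≤ ∑ b ∈ Gfar, (2 * δ' / (c * h) * (1 / |b - τ|) + 1) := by
          refine Finset.sum_le_sum fun b hb => ?_
          rw [hGfar, Finset.mem_filter] at hb
          have h1 := hfar b hb.1 hb.2
          have e : 2 * δ' / (c * |b - τ| * h) = 2 * δ' / (c * h) * (1 / |b - τ|) := by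
            have : 0 < |b - τ| := hh.trans_le hb.2
            field_simp
          linarith [h1, e.le, e.ge]
      _ = 2 * δ' / (c * h) * ∑ b ∈ Gfar, 1 / |b - τ| + Gfar.card := by
          rw [Finset.sum_add_distrib, Finset.mul_sum, Finset.sum_const, nsmul_eq_mul, mul_one]
      _ ≤ 2 * δ' / (c * h) * (2 * Lg / h) + (2 * ρ₀ / h + 1) := by
          have h1 : (Gfar.card : ℝ) ≤ 2 * ρ₀ / h + 1 :=
            le_trans (by exact_mod_cast Finset.card_le_card (Finset.filter_subset _ _)) hGcard
          have h2 := mul_le_mul_of_nonneg_left hsum_far (by positivity : 0 ≤ 2 * δ' / (c * h))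
          linarith
  -- the near rows together
  have hnear_sum : ∑ b ∈ Gnear, ((Row b).card : ℝ) ≤ 3 * (2 * ρ₀ / h + 1) := by
    calc ∑ b ∈ Gnear, ((Row b).card : ℝ) ≤ ∑ _b ∈ Gnear, (2 * ρ₀ / h + 1) := Finset.sum_le_sum fun b _ => hrow_triv b
      _ = Gnear.card * (2 * ρ₀ / h + 1) := by rw [Finset.sum_const, nsmul_eq_mul]
      _ ≤ 3 * (2 * ρ₀ / h + 1) := mul_le_mul_of_nonneg_right hnear_card (by positivity)
  -- the pair count
  have hWcard : (W.card : ℝ) ≤ 4 * (2 * ρ₀ / h + 1) + 4 * (δn + B * δt) / (c * h ^ 2) * Lg := by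
    rw [hWrows, ← Finset.sum_filter_add_sum_filter_not G (fun b => h ≤ |b - τ|)]
    have e : 2 * δ' / (c * h) * (2 * Lg / h) = 4 * (δn + B * δt) / (c * h ^ 2) * Lg := by
      rw [hδ']; field_simp; ring
    have hadd := add_le_add hfar_sum hnear_sum
    linarith [hadd, e.le, e.ge]
  -- assemble
  calc (T.card : ℝ) ≤ ((W.biUnion fun p => (C p).image fun g => (p, g)).card : ℝ) := by
        exact_mod_cast Finset.card_le_card hsub
    _ ≤ ∑ p ∈ W, (((C p).image fun g => (p, g)).card : ℝ) := by
        exact_mod_cast Finset.card_biUnion_le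
    _ ≤ ∑ _p ∈ W, (2 * δt / h + 1) := Finset.sum_le_sum fun p _ => hCcard p
    _ = W.card * (2 * δt / h + 1) := by rw [Finset.sum_const, nsmul_eq_mul]
    _ ≤ (4 * (2 * ρ₀ / h + 1) + 4 * (δn + B * δt) / (c * h ^ 2) * Lg) * (2 * δt / h + 1) :=
        mul_le_mul_of_nonneg_right hWcard (by positivity)
    _ = (2 * δt / h + 1) * (4 * (2 * ρ₀ / h + 1) + 4 * (δn + B * δt) / (c * h ^ 2) * Lg) := by ring

end Summit.HubbardSuperconductivity.HubbardSuperconductivity.Theorems.ThinLevelSet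

end
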